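import Summits.BirchSwinnertonDyer.BirchSwinnertonDyer.Theorems.CMKolyvaginAtInertTwoPairOfRatDataEigAtTwo
import Summits.BirchSwinnertonDyer.BirchSwinnertonDyer.Theorems.CMKolyvaginAtInertTwoPairOfRatDataAAtTwo
import Literature.NumberTheory.EllipticCurves.HeegnerPointsKolyvaginSplitDescentNegSign
import HarnessLib

/-!
# Route `CMKolyvaginAtInertTwo`, crux `CMKolyvaginExactAtInertTwo` (stmt-BirchSwinnertonDyer-24277):
# the `ℚ`-pair carrier with the TWIN in slot `V₁` — `heig`, `hA`, the sign bookkeeping at `ε = −1`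
# (root-number branch `w(E/ℚ) = +1`; KERNEL-STATUS-p2-port.md §17.13, step S2)

Seat `bsd-line-cmk2-p1` g17 (cell `bsd-print-cf2`); helper (`--supports stmt-BirchSwinnertonDyer-24277`).
THEOREMS ONLY: no definition, no named fact, no `sorry`; no item is closed; BSD is not proved by this.

In the branch `w(E/ℚ) = +1` Kolyvagin's class of `y_K` is `τ`-ANTI-invariant (Gross Prop. 5.4 (2) with `ε = −1`),
so the two-member data is `D' : PairDataM (H¹(ℚ, E^{(d_K)}[2^M])) (H¹(ℚ, E[2^M])) Pl` (the twin holds `x`), its split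
data is `D'.toSplitData.negSign` (`ε = −1`, `eig (−1) = V₁ × 0`, `eig 1 = 0 × V₂`; Literature `SplitDataM.negSign`),
and the pair map goes to `PairV W σ₀ M (−1) = H¹(K, E[2^M])^{−} × H¹(K, E[2^M])^{+}` with `(f v).1 = ψ (res v.1)`,
`(f v).2 = res v.2`. This file is p714768/p714773 with the two factors exchanged:

* `exists_pairOfRat_neg` — from an `E`-first pair map `f` (as produced by `exists_pairOfRat`) an injective
  twin-first map `f'` into `PairV … (−1)` with `(f' v).1 = ψ (res v.1)`, `(f' v).2 = res v.2`;
* `mem_toSplitData_negSign_eig_iff_mem_pairEig` (`heig` at `ε = −1`), `mem_toSplitData_negSign_A_iff_mem_pairA`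
  (`hA` at `ε = −1`), `fst_pairOfRatNeg_inr_eq_zero`, `snd_pairOfRatNeg_inl_eq_zero` (`hJ₂ε`, `hJ₁ε`),
  `mem_toSplitData_negSign_sel_iff`, `mem_toSplitData_negSign_A_iff`, `toSplitData_negSign_x`, `toSplitData_negSign_c`.

References: [Kolyvagin1989Izv] §3; [GrossLMS1991] §5 (5.1), Prop. 5.4 (2); [McCallumLMS1991] §3 (3), §4 Prop. 4.4, §5 (19).
-/

set_option linter.dupNamespace false -- tree convention: `Summit.BirchSwinnertonDyer.BirchSwinnertonDyer.Theorems` (summit = sub-problem)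
set_option autoImplicit false

noncomputable section

open scoped Classical
open WeierstrassCurve NumberField IsDedekindDomain Field Rat.HeightOneSpectrum
open Literature.NumberTheory.GaloisRepresentations
open Literature.NumberTheory.EllipticCurves Literature.NumberTheory.EllipticCurves.KolyvaginDescent
open Summit.BirchSwinnertonDyer.BirchSwinnertonDyer.Theorems.GenusExact.EigenClassesFinite
open Summit.BirchSwinnertonDyer.BirchSwinnertonDyer.Theorems.GenusExact.VisiblePairAtTwo

namespace Summit.BirchSwinnertonDyer.BirchSwinnertonDyer.Theorems.KolyvaginPairDataTwo

variable {N : ℕ} (W : WeierstrassCurve ℚ) (K : Type) [Field K] [NumberField K]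
  (h2 : Module.finrank ℚ K = 2) {θ : K} (hθ : θ ∉ Set.range (algebraMap ℚ K))
  (hd : θ ^ 2 = algebraMap ℚ K ((NumberField.discr K : ℤ) : ℚ)) (M : ℕ)

/-! ## The twin-first pair map into `PairV … (−1)` -/

/-- **The twin-first pair map.** From an additive `f : H¹(ℚ,E[2^M]) × H¹(ℚ,E^{(d_K)}[2^M]) → V^{+} × V^{−}` with
`(f v).1 = res v.1`, `(f v).2 = ψ (res v.2)`, injective: an injective additive
`f' : H¹(ℚ,E^{(d_K)}[2^M]) × H¹(ℚ,E[2^M]) → V^{−} × V^{+} = PairV … (−1)` with `(f' v).1 = ψ (res v.1)`, `(f' v).2 = res v.2`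
(exchange the factors; `V^{−(−1)} = V^{+}`). [cite: Kolyvagin1989Izv, §3] [cite: GrossLMS1991, §5 (5.1)] -/
theorem exists_pairOfRat_neg
    (f : galH1Torsion W (lvl M) × galH1Torsion (twin W K) (lvl M) →+ PairV W (sigmaQ K h2 hθ hd) M 1)
    (hf : Function.Injective f)
    (hf₁ : ∀ v, ((f v).1 : galH1Torsion (W.baseChange K) ((2 ^ M : ℕ) : ℤ)) = resTorsion W K (lvl M) v.1)
    (hf₂ : ∀ v, ((f v).2 : galH1Torsion (W.baseChange K) ((2 ^ M : ℕ) : ℤ)) =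
      hPsiKT W K hθ hd (lvl M) (resTorsion (twin W K) K (lvl M) v.2)) :
    ∃ f' : galH1Torsion (twin W K) (lvl M) × galH1Torsion W (lvl M) →+ PairV W (sigmaQ K h2 hθ hd) M (-1),
      Function.Injective f' ∧
      (∀ v, ((f' v).1 : galH1Torsion (W.baseChange K) ((2 ^ M : ℕ) : ℤ)) =
        hPsiKT W K hθ hd (lvl M) (resTorsion (twin W K) K (lvl M) v.1)) ∧
      (∀ v, ((f' v).2 : galH1Torsion (W.baseChange K) ((2 ^ M : ℕ) : ℤ)) = resTorsion W K (lvl M) v.2) := by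
  have hle : eigK W (sigmaQ K h2 hθ hd) M 1 ≤ eigK W (sigmaQ K h2 hθ hd) M (-(-1)) := by rw [neg_neg]
  let sw : galH1Torsion (twin W K) (lvl M) × galH1Torsion W (lvl M) →+
      galH1Torsion W (lvl M) × galH1Torsion (twin W K) (lvl M) :=
    (AddEquiv.prodComm : galH1Torsion (twin W K) (lvl M) × galH1Torsion W (lvl M) ≃+
      galH1Torsion W (lvl M) × galH1Torsion (twin W K) (lvl M)).toAddMonoidHom
  let g := f.comp sw
  refine ⟨((AddMonoidHom.snd _ _).comp g).prod ((AddSubgroup.inclusion hle).comp ((AddMonoidHom.fst _ _).comp g)),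
    ?_, fun v ↦ ?_, fun v ↦ ?_⟩
  · intro v w hvw
    have h1 : (f (sw v)).2 = (f (sw w)).2 := congrArg Prod.fst hvw
    have h2' : AddSubgroup.inclusion hle (f (sw v)).1 = AddSubgroup.inclusion hle (f (sw w)).1 :=
      congrArg Prod.snd hvw
    have h2'' : (f (sw v)).1 = (f (sw w)).1 := AddSubgroup.inclusion_injective hle h2'
    have hsw : sw v = sw w := hf (Prod.ext h2'' h1)
    exact (AddEquiv.prodComm : galH1Torsion (twin W K) (lvl M) × galH1Torsion W (lvl M) ≃+
      galH1Torsion W (lvl M) × galH1Torsion (twin W K) (lvl M)).injective hsw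
  · change (((f (sw v)).2 : galH1Torsion (W.baseChange K) ((2 ^ M : ℕ) : ℤ))) = _
    rw [hf₂]
    rfl
  · change ((AddSubgroup.inclusion hle (f (sw v)).1 : galH1Torsion (W.baseChange K) ((2 ^ M : ℕ) : ℤ))) = _
    rw [AddSubgroup.coe_inclusion, hf₁]
    rfl

/-! ## `heig` at `ε = −1` -/

/-- **`heig` for the twin-first `ℚ`-pair carrier.** For `D' : PairDataM (H¹(ℚ, E^{(d_K)}[2^M])) (H¹(ℚ, E[2^M])) Pl`,
an injective additive `f'` into `PairV W σ₀ M (−1)` with `(f' v).1 = ψ (res v.1)`, `(f' v).2 = res v.2`, and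
`E(K)[2^M] = 0`: `v ∈ D'.toSplitData.negSign.eig e ↔ f' v ∈ pairEig W σ₀ M (−1) e` for EVERY `e : ℤ`.
[cite: Kolyvagin1989Izv, §3] [cite: GrossLMS1991, §5 (5.1), Prop. 5.4 (2)] -/
theorem mem_toSplitData_negSign_eig_iff_mem_pairEig
    (hL : ∀ P : (W.baseChange K).toAffine.Point, ((2 ^ M : ℕ) : ℤ) • P = 0 → P = 0)
    {Pl : Type*} (D : PairDataM (galH1Torsion (twin W K) (lvl M)) (galH1Torsion W (lvl M)) Pl)
    (f : galH1Torsion (twin W K) (lvl M) × galH1Torsion W (lvl M) →+ PairV W (sigmaQ K h2 hθ hd) M (-1))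
    (hf : Function.Injective f)
    (hf₁ : ∀ v, ((f v).1 : galH1Torsion (W.baseChange K) ((2 ^ M : ℕ) : ℤ)) =
      hPsiKT W K hθ hd (lvl M) (resTorsion (twin W K) K (lvl M) v.1))
    (hf₂ : ∀ v, ((f v).2 : galH1Torsion (W.baseChange K) ((2 ^ M : ℕ) : ℤ)) = resTorsion W K (lvl M) v.2)
    (e : ℤ) (v : galH1Torsion (twin W K) (lvl M) × galH1Torsion W (lvl M)) :
    v ∈ D.toSplitData.negSign.eig e ↔ f v ∈ pairEig W (sigmaQ K h2 hθ hd) M (-1) e := by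
  by_cases he1 : e = -1
  · subst he1
    rw [PairDataM.mem_toSplitData_negSign_eig_neg_one_iff, pairEig_self, AddSubgroup.mem_prod]
    simp only [AddSubgroup.mem_top, true_and, AddSubgroup.mem_bot]
    constructor
    · intro hv
      apply Subtype.ext
      rw [hf₂, hv, map_zero]
      rfl
    · intro hv
      have h := hf₂ v
      rw [hv] at h
      exact resTorsion_injective_of_noTorsion W K h2 hθ hd (lvl M) hL (by rw [← h, map_zero]; rfl)
  by_cases he2 : e = 1
  · subst he2
    rw [PairDataM.mem_toSplitData_negSign_eig_one_iff, pairEig, if_neg (by decide), if_pos (by decide),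
      AddSubgroup.mem_prod]
    simp only [AddSubgroup.mem_top, and_true, AddSubgroup.mem_bot]
    constructor
    · intro hv
      apply Subtype.ext
      rw [hf₁, hv, map_zero, map_zero]
      rfl
    · intro hv
      have h := hf₁ v
      rw [hv] at h
      have h0 : hPsiKT W K hθ hd (lvl M) (resTorsion (twin W K) K (lvl M) v.1) = 0 := h.symm
      rw [map_eq_zero_iff _ (hPsiKT W K hθ hd (lvl M)).injective] at h0
      exact resTorsion_twist_injective_of_noTorsion W K h2 hθ hd (lvl M) hL (by rw [h0, map_zero])
  · -- junk sign: both sides are `⊥`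
    have he1' : -e ≠ 1 := fun h ↦ he1 (by omega)
    have he2' : -e ≠ -1 := fun h ↦ he2 (by omega)
    rw [SplitDataM.mem_negSign_eig_iff, PairDataM.toSplitData_eig, PairDataM.eig_of_ne he1' he2',
      AddSubgroup.mem_bot, pairEig, if_neg he1, if_neg (by omega), AddSubgroup.mem_bot]
    constructor
    · rintro rfl
      exact map_zero f
    · intro h
      exact hf (by rw [h, map_zero])

/-! ## The bookkeeping compatibilities for `toSplitData.negSign` -/

/-- **`hJ₁ε`** (twin-first): `(f (u, 0)).2 = 0`. [cite: Kolyvagin1989Izv, §3] -/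
theorem snd_pairOfRatNeg_inl_eq_zero
    (f : galH1Torsion (twin W K) (lvl M) × galH1Torsion W (lvl M) →+ PairV W (sigmaQ K h2 hθ hd) M (-1))
    (hf₂ : ∀ v, ((f v).2 : galH1Torsion (W.baseChange K) ((2 ^ M : ℕ) : ℤ)) = resTorsion W K (lvl M) v.2)
    (u : galH1Torsion (twin W K) (lvl M)) : (f (u, 0)).2 = 0 := by
  apply Subtype.ext
  rw [hf₂, map_zero]
  rfl

/-- **`hJ₂ε`** (twin-first): `(f (0, w)).1 = 0`. [cite: Kolyvagin1989Izv, §3] -/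
theorem fst_pairOfRatNeg_inr_eq_zero
    (f : galH1Torsion (twin W K) (lvl M) × galH1Torsion W (lvl M) →+ PairV W (sigmaQ K h2 hθ hd) M (-1))
    (hf₁ : ∀ v, ((f v).1 : galH1Torsion (W.baseChange K) ((2 ^ M : ℕ) : ℤ)) =
      hPsiKT W K hθ hd (lvl M) (resTorsion (twin W K) K (lvl M) v.1))
    (w : galH1Torsion W (lvl M)) : (f (0, w)).1 = 0 := by
  apply Subtype.ext
  rw [hf₁, map_zero, map_zero]
  rfl

/-- `v ∈ toSplitData.negSign.Sel ↔ v.1 ∈ Sel₁ ∧ v.2 ∈ Sel₂`. [cite: McCallumLMS1991, §4] -/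
theorem mem_toSplitData_negSign_sel_iff {V₁ V₂ : Type*} [AddCommGroup V₁] [AddCommGroup V₂] {Pl : Type*}
    (D : PairDataM V₁ V₂ Pl) (v : V₁ × V₂) :
    v ∈ D.toSplitData.negSign.Sel ↔ v.1 ∈ D.Sel₁ ∧ v.2 ∈ D.Sel₂ :=
  D.mem_toSplitData_sel_iff v

/-- `v ∈ toSplitData.negSign.A ℓ ↔ v.1 ∈ A₁ ℓ ∧ v.2 ∈ A₂ ℓ`. [cite: McCallumLMS1991, §5 (19)] -/
theorem mem_toSplitData_negSign_A_iff {V₁ V₂ : Type*} [AddCommGroup V₁] [AddCommGroup V₂] {Pl : Type*}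
    (D : PairDataM V₁ V₂ Pl) (ℓ : ℕ) (v : V₁ × V₂) :
    v ∈ D.toSplitData.negSign.A ℓ ↔ v.1 ∈ D.A₁ ℓ ∧ v.2 ∈ D.A₂ ℓ :=
  D.mem_toSplitData_A_iff ℓ v

/-- `toSplitData.negSign.x = (x, 0)`. [cite: McCallumLMS1991, §5 Thm. 5.4 (proof)] -/
theorem toSplitData_negSign_x {V₁ V₂ : Type*} [AddCommGroup V₁] [AddCommGroup V₂] {Pl : Type*}
    (D : PairDataM V₁ V₂ Pl) : D.toSplitData.negSign.x = (D.x, 0) := rfl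

/-- `toSplitData.negSign.c = pairClass c₁ c₂`. [cite: GrossLMS1991, Prop. 5.4 (2)] -/
theorem toSplitData_negSign_c {V₁ V₂ : Type*} [AddCommGroup V₁] [AddCommGroup V₂] {Pl : Type*}
    (D : PairDataM V₁ V₂ Pl) (n : ℕ) : D.toSplitData.negSign.c n = pairClass D.c₁ D.c₂ n := rfl

/-- `toSplitData.negSign.Kol ↔ Q` when `D.Kol ↔ Q`. [cite: McCallumLMS1991, §3] -/
theorem toSplitData_negSign_kol_iff_of_kol {V₁ V₂ : Type*} [AddCommGroup V₁] [AddCommGroup V₂] {Pl : Type*}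
    (D : PairDataM V₁ V₂ Pl) (Q : ℕ → Prop) (hQ : ∀ ℓ, D.Kol ℓ ↔ Q ℓ) (ℓ : ℕ) :
    D.toSplitData.negSign.Kol ℓ ↔ Q ℓ :=
  (D.toSplitData_kol_iff ℓ).trans (hQ ℓ)

/-! ## `hA` at `ε = −1` -/

variable {K} in
/-- **`hA` for the twin-first `ℚ`-pair carrier**: for `D'` with `D'.A₁ = a₂ W K M` (the twin's strict condition),
`D'.A₂ = a₁ W M`, and `f'` with `(f' v).1 = ψ (res v.1)`, `(f' v).2 = res v.2`, at every Gross-form Kolyvagin prime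
`ℓ` of good reduction with `Frob_ℓ ∼ τ` on `E[2^M]`: `v ∈ D'.toSplitData.negSign.A ℓ ⟺ f' v ∈ pairA … (−1) ℓ`.
[cite: McCallumLMS1991, §3 (3), §4 Prop. 4.4] [cite: Kolyvagin1989Izv, §3] -/
theorem mem_toSplitData_negSign_A_iff_mem_pairA [NeZero N] [W.IsElliptic] [(twin W K).IsElliptic]
    (hK : IsImaginaryQuadratic K) (hodd : Odd (NumberField.discr K)) (hΔ : W.Δ < 0) (hM : 1 ≤ M)
    {Pl : Type*} (D : PairDataM (galH1Torsion (twin W K) (lvl M)) (galH1Torsion W (lvl M)) Pl)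
    (hDA₁ : D.A₁ = a₂ W K M) (hDA₂ : D.A₂ = a₁ W M)
    (f : galH1Torsion (twin W K) (lvl M) × galH1Torsion W (lvl M) →+ PairV W (sigmaQ K h2 hθ hd) M (-1))
    (hf₁ : ∀ v, ((f v).1 : galH1Torsion (W.baseChange K) ((2 ^ M : ℕ) : ℤ)) =
      hPsiKT W K hθ hd (lvl M) (resTorsion (twin W K) K (lvl M) v.1))
    (hf₂ : ∀ v, ((f v).2 : galH1Torsion (W.baseChange K) ((2 ^ M : ℕ) : ℤ)) = resTorsion W K (lvl M) v.2)
    {ℓ : ℕ} (hℓ : IsKolyvaginPrime N W K 2 ℓ) (hgood : (haveI : Fact ℓ.Prime := ⟨hℓ.prime⟩;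
      W.HasGoodReductionAtPrime ℓ)) (hℓM : FrobEqFrobInfty W K (2 ^ M) ℓ)
    (v : galH1Torsion (twin W K) (lvl M) × galH1Torsion W (lvl M)) :
    v ∈ D.toSplitData.negSign.A ℓ ↔ f v ∈ pairA (N := N) W (sigmaQ K h2 hθ hd) M (-1) ℓ := by
  rw [mem_toSplitData_negSign_A_iff, hDA₁, hDA₂, mem_a₁_iff hℓ.prime, mem_a₂_iff hℓ.prime,
    mem_pairA_iff W (sigmaQ K h2 hθ hd) M hℓ, hf₁, hf₂,
    mem_torsionLocalKer_iff_resTorsion_mem_place W hΔ h2 hθ hd hM hℓ hgood hℓM,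
    mem_torsionLocalKer_twin_iff_hPsiKT_mem_place W hK hodd hΔ h2 hθ hd hM hℓ hgood hℓM]

end Summit.BirchSwinnertonDyer.BirchSwinnertonDyer.Theorems.KolyvaginPairDataTwo

end
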